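import Summits.NavierStokesRegularity.NavierStokesRegularity.Theorems.HeredityAtOne.Negative.NestedHillProfile

/-!
# The nested-Hill stream profile `G` (1-D part of the S⁺ witness against `SliceHeredityAtOne`, II)

Cell `ns-blowup`, seat `ns-blowup-refuter4` (g5), NEGATIVE lane of item 19249 `HeredityAtOne`
(`--supports`; nothing here asserts a route statement). Companion of `NestedHillProfile.lean` (the
vorticity-moment profile `H` of the smoothed Hill vortex, data `P : HillData`). THIS file: the stream profile

* `G q = g₀ − (q/2) ∫₀¹ H(t q) dt` (`= g₀ − ½ ∫₀^q H`, `G_eq_primitive`), with the dipole-matching constant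
  `g₀ = ½ ∫₀^{q₂} H + q₂ H(q₂)/3`,

smooth, with `G′ = −H/2` (`hasDerivAt_G`, the identity carrying `div v = 0` in the field file), the exact
dipole identity `G(q) − q H(q)/3 = (A/6) ∫_q^{q₂} φ` (`G_sub_eq`: both sides have derivative `−Aφ/6` by
`two_mul_deriv_H`, and agree at `q₂`), hence the core form `G = g₀ − A q/10` (Hill's interior stream
profile), the exterior form `G = q H/3` (the dipole), `g₀ = (A/6)∫₀^{q₂} φ ∈ [A q₁/6, A q₂/6]`, and the
register bounds `0 ≤ G ≤ g₀`, `q H(q) ≤ q₂ A/5`, `2 G ≤ A q₂/3` on `q ≥ 0`.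

LABEL: kernel calculus; no named fact; nothing about Navier–Stokes. [folklore] (Hill 1894; Acheson,
Elementary Fluid Dynamics §5.5, cf. `Literature/Analysis/FluidPDE/HillSphericalVortex.lean`.)
-/

noncomputable section

namespace Summit.NavierStokesRegularity.HeredityAtOneNestedHill

open Set MeasureTheory intervalIntegral Filter Topology

namespace HillData

variable (P : HillData)

/-! ## §4 The stream profile `G` -/

/-- The dipole-matching constant `g₀ = ½ ∫₀^{q₂} H + q₂ H(q₂)/3`. [folklore] -/
def g₀ : ℝ := 1 / 2 * (∫ s in (0 : ℝ)..P.q₂, P.H s) + P.q₂ * P.H P.q₂ / 3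

/-- `G(q) = g₀ − (q/2) ∫₀¹ H(t q) dt`. [folklore] -/
def G (q : ℝ) : ℝ := P.g₀ - q / 2 * ∫ t in (0 : ℝ)..1, P.H (t * q)

/-- `G` is smooth. [folklore] -/
theorem G_contDiff {n : ℕ∞} : ContDiff ℝ n P.G := by
  unfold G
  refine contDiff_const.sub ((contDiff_id.div_const _).mul ?_)
  have h : ContDiff ℝ n (Function.uncurry fun (q t : ℝ) => P.H (t * q)) := by
    change ContDiff ℝ n (fun p : ℝ × ℝ => P.H (p.2 * p.1))
    exact P.H_contDiff.comp (contDiff_snd.mul contDiff_fst)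
  exact Literature.Analysis.Calculus.contDiff_intervalIntegral h 0 1

/-- `G` is continuous. [folklore] -/
theorem G_continuous : Continuous P.G := (P.G_contDiff (n := 0)).continuous

/-- `G = g₀ − ½ ∫₀^q H` (substitution `s = t q`). [folklore] -/
theorem G_eq_primitive (q : ℝ) : P.G q = P.g₀ - 1 / 2 * ∫ s in (0 : ℝ)..q, P.H s := by
  unfold G
  rcases eq_or_ne q 0 with rfl | hq
  · simp
  · rw [intervalIntegral.integral_comp_mul_right (fun s => P.H s) hq, zero_mul, one_mul, smul_eq_mul]
    field_simp

/-- `G(0) = g₀`. [folklore] -/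
@[simp] theorem G_zero : P.G 0 = P.g₀ := by
  rw [P.G_eq_primitive, integral_same, mul_zero, sub_zero]

/-- **`G′ = −H/2`.** [folklore] -/
theorem hasDerivAt_G (q : ℝ) : HasDerivAt P.G (-P.H q / 2) q := by
  have h : HasDerivAt (fun q => P.g₀ - 1 / 2 * ∫ s in (0 : ℝ)..q, P.H s) (0 - 1 / 2 * P.H q) q :=
    (hasDerivAt_const q _).sub
      ((P.H_continuous.integral_hasStrictDerivAt 0 q).hasDerivAt.const_mul (1 / 2))
  have heq : P.G = fun q => P.g₀ - 1 / 2 * ∫ s in (0 : ℝ)..q, P.H s := funext P.G_eq_primitive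
  rw [heq]
  convert h using 1
  ring

/-- `G` is differentiable. [folklore] -/
theorem G_differentiable : Differentiable ℝ P.G := fun q => (P.hasDerivAt_G q).differentiableAt

/-- `deriv G = −H/2`. [folklore] -/
theorem deriv_G (q : ℝ) : deriv P.G q = -P.H q / 2 := (P.hasDerivAt_G q).deriv

/-- **The dipole identity `G(q) − q H(q)/3 = (A/6) ∫_q^{q₂} φ`** (both sides have derivative `−A φ/6`
by `two_mul_deriv_H` and `G′ = −H/2`, and agree at `q = q₂` by the choice of `g₀`). [folklore] -/
theorem G_sub_eq (q : ℝ) :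
    P.G q - q * P.H q / 3 = P.A / 6 * ∫ s in q..P.q₂, P.cutoff s := by
  -- the difference `D` has zero derivative everywhere
  set D : ℝ → ℝ := fun q => P.G q - q * P.H q / 3 - P.A / 6 * ∫ s in q..P.q₂, P.cutoff s with hDdef
  have hderiv : ∀ s, HasDerivAt D 0 s := by
    intro s
    have hG := P.hasDerivAt_G s
    have hH := P.hasDerivAt_H s
    have hqH : HasDerivAt (fun q : ℝ => q * P.H q / 3) ((1 * P.H s + s * deriv P.H s) / 3) s :=
      ((hasDerivAt_id s).mul hH).div_const 3
    have hI : HasDerivAt (fun q : ℝ => ∫ x in q..P.q₂, P.cutoff x) (-P.cutoff s) s := by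
      have h := (P.cutoff_continuous.integral_hasStrictDerivAt P.q₂ s).hasDerivAt
      have heq : (fun q : ℝ => ∫ x in q..P.q₂, P.cutoff x) = fun q => -∫ x in P.q₂..q, P.cutoff x :=
        funext fun q => integral_symm _ _
      rw [heq]
      exact h.neg
    have hD : HasDerivAt D (-P.H s / 2 - (1 * P.H s + s * deriv P.H s) / 3 - P.A / 6 * -P.cutoff s) s :=
      (hG.sub hqH).sub (hI.const_mul _)
    convert hD using 1
    have := P.two_mul_deriv_H s
    linarith
  have hdiff : Differentiable ℝ D := fun s => (hderiv s).differentiableAt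
  have hconst := is_const_of_deriv_eq_zero hdiff (fun s => (hderiv s).deriv) q P.q₂
  -- value at `q₂`
  have hq₂ : D P.q₂ = 0 := by
    simp only [hDdef, integral_same, mul_zero, sub_zero]
    rw [P.G_eq_primitive]
    unfold g₀
    ring
  have : D q = 0 := hconst.trans hq₂
  simp only [hDdef] at this
  linarith

/-- **Exterior (dipole) form**: `G = q H/3` on `q₂ ≤ q`. [folklore] -/
theorem G_eq_exterior {q : ℝ} (hq : P.q₂ ≤ q) : P.G q = q * P.H q / 3 := by
  have h := P.G_sub_eq q
  have h0 : ∫ s in q..P.q₂, P.cutoff s = 0 := by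
    rw [← intervalIntegral.integral_zero (a := q) (b := P.q₂)]
    refine integral_congr fun s hs => ?_
    rw [uIcc_of_ge hq] at hs
    exact P.cutoff_eq_zero hs.1
  rw [h0, mul_zero, sub_eq_zero] at h
  exact h

/-- **`g₀ = (A/6) ∫₀^{q₂} φ`** (`G_sub_eq` at `q = 0`). [folklore] -/
theorem g₀_eq : P.g₀ = P.A / 6 * ∫ s in (0 : ℝ)..P.q₂, P.cutoff s := by
  have h := P.G_sub_eq 0
  rw [P.G_eq_primitive, integral_same] at h
  simpa using h

/-- `g₀ ≤ A q₂/6` (`φ ≤ 1`). [folklore] -/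
theorem g₀_le : P.g₀ ≤ P.A * P.q₂ / 6 := by
  rw [P.g₀_eq]
  have h : (∫ s in (0 : ℝ)..P.q₂, P.cutoff s) ≤ ∫ _ in (0 : ℝ)..P.q₂, (1 : ℝ) :=
    intervalIntegral.integral_mono_on P.q₂_pos.le (P.cutoff_continuous.intervalIntegrable _ _)
      (continuous_const.intervalIntegrable _ _) fun s _ => P.cutoff_le_one s
  rw [intervalIntegral.integral_const, smul_eq_mul, mul_one, sub_zero] at h
  have hA : 0 ≤ P.A / 6 := by linarith [P.A_pos]
  calc P.A / 6 * ∫ s in (0 : ℝ)..P.q₂, P.cutoff s ≤ P.A / 6 * P.q₂ := mul_le_mul_of_nonneg_left h hA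
    _ = P.A * P.q₂ / 6 := by ring

/-- `A q₁/6 ≤ g₀` (`φ = 1` on `[0, q₁]`, `φ ≥ 0` on `[q₁, q₂]`). [folklore] -/
theorem le_g₀ : P.A * P.q₁ / 6 ≤ P.g₀ := by
  rw [P.g₀_eq]
  have hsplit : (∫ s in (0 : ℝ)..P.q₁, P.cutoff s) + ∫ s in P.q₁..P.q₂, P.cutoff s =
      ∫ s in (0 : ℝ)..P.q₂, P.cutoff s :=
    integral_add_adjacent_intervals (P.cutoff_continuous.intervalIntegrable _ _)
      (P.cutoff_continuous.intervalIntegrable _ _)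
  have h1 : ∫ s in (0 : ℝ)..P.q₁, P.cutoff s = P.q₁ := by
    have : ∫ s in (0 : ℝ)..P.q₁, P.cutoff s = ∫ _ in (0 : ℝ)..P.q₁, (1 : ℝ) := by
      refine integral_congr fun s hs => ?_
      rw [uIcc_of_le P.q₁_pos.le] at hs
      exact P.cutoff_eq_one hs.2
    rw [this, intervalIntegral.integral_const, smul_eq_mul, mul_one, sub_zero]
  have h2 : 0 ≤ ∫ s in P.q₁..P.q₂, P.cutoff s :=
    intervalIntegral.integral_nonneg P.q₁_lt_q₂.le fun s _ => P.cutoff_nonneg s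
  rw [← hsplit, h1]
  have hA : 0 ≤ P.A / 6 := by linarith [P.A_pos]
  nlinarith

/-- `0 < g₀`. [folklore] -/
theorem g₀_pos : 0 < P.g₀ :=
  lt_of_lt_of_le (by have := P.A_pos; have := P.q₁_pos; positivity) P.le_g₀

/-- **Core form**: `G = g₀ − A q/10` on `q ≤ q₁` (Hill's interior stream profile). [folklore] -/
theorem G_eq_core {q : ℝ} (hq : q ≤ P.q₁) : P.G q = P.g₀ - P.A * q / 10 := by
  rw [P.G_eq_primitive]
  have h : ∫ s in (0 : ℝ)..q, P.H s = ∫ _ in (0 : ℝ)..q, P.A / 5 := by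
    refine integral_congr fun s hs => P.H_eq_core ?_
    rcases le_or_gt 0 q with h0 | h0
    · rw [uIcc_of_le h0] at hs; exact hs.2.trans hq
    · rw [uIcc_of_ge h0.le] at hs; exact hs.2.trans (P.q₁_pos.le)
  rw [h, intervalIntegral.integral_const, smul_eq_mul]
  ring

/-- `G ≤ g₀` on `0 ≤ q`. [folklore] -/
theorem G_le_g₀ {q : ℝ} (hq : 0 ≤ q) : P.G q ≤ P.g₀ := by
  rw [P.G_eq_primitive]
  have : 0 ≤ ∫ s in (0 : ℝ)..q, P.H s := intervalIntegral.integral_nonneg hq fun s _ => P.H_nonneg s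
  linarith

/-- `0 ≤ G` on `0 ≤ q`. [folklore] -/
theorem G_nonneg {q : ℝ} (hq : 0 ≤ q) : 0 ≤ P.G q := by
  have h := P.G_sub_eq q
  have hI : 0 ≤ ∫ s in q..P.q₂, P.cutoff s := by
    rcases le_or_gt q P.q₂ with hq₂ | hq₂
    · exact intervalIntegral.integral_nonneg hq₂ fun s _ => P.cutoff_nonneg s
    · rw [← intervalIntegral.integral_zero (a := q) (b := P.q₂)]
      refine (integral_congr fun s hs => ?_).symm.le
      rw [uIcc_of_ge hq₂.le] at hs
      exact P.cutoff_eq_zero hs.1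
  have h1 : 0 ≤ q * P.H q / 3 := by have := P.H_nonneg q; positivity
  have hA : 0 ≤ P.A / 6 := by linarith [P.A_pos]
  nlinarith

/-- **The second moment is capped by the core**: `q H(q) ≤ q₂ A/5` for `0 ≤ q` (on `[0, q₂]` by `H ≤ A/5`;
beyond, `s ↦ s H(s)` is non-increasing since its derivative is `(A φ − 3 H)/2 = −3H/2 ≤ 0`). [folklore] -/
theorem mul_H_le {q : ℝ} (hq : 0 ≤ q) : q * P.H q ≤ P.q₂ * (P.A / 5) := by
  rcases le_or_gt q P.q₂ with hq₂ | hq₂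
  · calc q * P.H q ≤ q * (P.A / 5) := mul_le_mul_of_nonneg_left (P.H_le q) hq
      _ ≤ P.q₂ * (P.A / 5) := mul_le_mul_of_nonneg_right hq₂ (by linarith [P.A_pos])
  · have hanti : AntitoneOn (fun s : ℝ => s * P.H s) (Ici P.q₂) := by
      refine antitoneOn_of_deriv_nonpos (convex_Ici _)
        ((continuous_id.mul P.H_continuous).continuousOn)
        (fun s _ => ((differentiableAt_id).mul (P.H_differentiable s)).differentiableWithinAt) ?_
      intro s hs
      rw [interior_Ici] at hs
      have hs' : P.q₂ ≤ s := le_of_lt hs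
      have hd : HasDerivAt (fun s : ℝ => s * P.H s) (1 * P.H s + s * deriv P.H s) s :=
        (hasDerivAt_id' s).mul (P.hasDerivAt_H s)
      rw [hd.deriv]
      have h2 := P.two_mul_deriv_H s
      rw [P.cutoff_eq_zero hs', mul_zero, zero_sub] at h2
      have hs0 : 0 < s := P.q₂_pos.trans hs
      have hH := P.H_nonneg s
      nlinarith
    have h := hanti (self_mem_Ici (a := P.q₂)) (le_of_lt hq₂ : P.q₂ ≤ q) (le_of_lt hq₂)
    calc q * P.H q ≤ P.q₂ * P.H P.q₂ := h
      _ ≤ P.q₂ * (P.A / 5) := mul_le_mul_of_nonneg_left (P.H_le _) P.q₂_pos.le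

/-- `2 G(q) ≤ A q₂/3` on `0 ≤ q`. [folklore] -/
theorem two_mul_G_le {q : ℝ} (hq : 0 ≤ q) : 2 * P.G q ≤ P.A * P.q₂ / 3 := by
  have := P.G_le_g₀ hq
  have := P.g₀_le
  linarith

end HillData

end Summit.NavierStokesRegularity.HeredityAtOneNestedHill

end
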